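import Literature.IUT.HodgeTheaters.GenuineFKitMergeInputsLiftsAll
import Literature.AlgebraicGeometry.Frobenioids.PadicFrobenioidBaseTransport
import Literature.AlgebraicGeometry.Frobenioids.ModelFrobenioidBaseChangeEquivalence
import HarnessLib

/-!
# [IUTchI] Cor 5.3 (ii), surjectivity half at the genuine good place: the Γ-INNER transporters of `Π_v̲` LIFT to self-equivalences of the
# genuine `𝒞_v̲` (a THEOREM about abc-iut-L5-t2's construction `goodLocalFrobenioidAt`; L5 base-merge sequel, racer B FILE 6 «LIFTSALL-GAMMA-INNER@GOOD»)

S. Mochizuki, *Inter-universal Teichmüller theory I*, kurims manuscript (May 2020), §5 Corollary 5.3 (ii) p. 144 and the argument printed for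
(iv), p. 144 l. 41–43 («Since automorphisms of `𝒟_v = ℬ^temp(X̲̲_v)⁰` necessarily arise from automorphisms of the scheme `X̲̲_v` … surjectivity follows
immediately from the construction of `ℱ̲_v`»); Def 3.1 (e)(f) pp. 62–63; Ex 3.3 (i) p. 78 ([IUTchI] Cor 5.3 (ii) p.144) [claim: Mochizuki2012, status: disputed]
(D-0012 claim key; CONSTRUCTIONS and PROOFS over landed files; nothing of the series is asserted; no side is taken on [IUTchIII] Cor. 3.12).
S. Mochizuki, *The geometry of Frobenioids I*, Kyushu J. Math. **62** (2008), Thm. 5.2 (i) p. 100, Cor. 5.4 p. 104 [cite: MochizukiFrdI2008, Cor. 5.4 p.104];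
*The geometry of Frobenioids II*, Kyushu J. Math. **62** (2008), Ex. 1.1 (ii) p. 8, Ex. 1.3 (ii) p. 11 [cite: MochizukiFrdII2008, Ex 1.3 (ii) p.11].

## What this file proves (cell abc-iut; the OPEN half «LiftsAll» of the Cor 5.3 (ii) good-place reading at the (S1) slot of record, ★ p498387 / p501097)

* §A `PiTransport.conjPushIso` — for a Γ-INNER automorphism `φ` of `Π ↠ Γ` (`aug ∘ φ = conj γ ∘ aug`): the natural isomorphism
  `pull φ ⋙ push aug ≅ push aug` of small coset categories (`aug(φ⁻¹U) = γ⁻¹ aug(U) γ`; components = the coset map of `γ⁻¹`).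
* §B `GammaInnerLift.dataHomOver / lift / lift_comp_toBase / lift_isEquivalence / exists_selfEquivalence_liesUnder_pullSelfEquiv` — AT THE REAL
  `GoodLocalFrobenioid.ofGalois d aug …` (`𝒞_v` = model Frobenioid of `Datum.perf (push aug ⋙ fieldFunctor)`, whose data ARE the restriction along `push aug`
  of the Γ-level perfection datum — abc-iut-L1-t4 `perf_proj_eq_restrict`, rfl): abc-iut-L1 `ModelFrobenioid.restrictAlong` along `conjPushIso` IS a
  `DataHomOver (pull φ)` for `𝒞_v`'s own data; its functor `Ψ_φ : 𝒞_v ⥤ 𝒞_v` lies over `pull φ` ON THE NOSE (abc-iut-w5-d048 `functor_comp_baseFunctor`)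
  and is an EQUIVALENCE (abc-iut-w5-d137 `functor_isEquivalence`: components = `Φ`, `B` of an iso) — **every Γ-inner automorphism of `(Π_v ↠ G_v)` with
  continuous inverse lifts to a self-equivalence of `𝒞_v` lying under `pullSelfEquiv φ ψ` through `toBase`.**
* §C `InitialThetaData.transporterEnd` — a transporter `n ∈ N_{Π_{C_F}}(Π_{(−)} ∩ augGF⁻¹ρ(Γ))` read on `Π_{(−)} ×_{G_F} Γ` through `piLocEquiv`
  (★ p498387): continuous, mutually inverse with `transporterEnd n⁻¹`, and Γ-INNER when `augGF n = ρ γ` (`augLoc_transporterEnd`, by injectivity of `ρ`).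
* §D (companion `GenuineFKitMergeInputsLiftsGammaInnerAtTerm.lean`): the `n`-clause of `goodLiftsAllAt_iff` (★ p501097) for every Γ-inner transporter
  at the merge term's `frobeniusGoodAt`, from §B + §C.
RESIDUAL (honest): `LiftsAll` at the good slot = THIS for Γ-inner `n` ∧ the non-Γ-inner transporters (`augGF n ∈ N_{G_F}(G_{K,w}) ∖ G_{K,w}`, the
`Gal(K_v̲/F_v)`-part) which need the F_v-semilinear action of `G_{F,w̄}` on `K̄_v̲` — number-theoretic infrastructure NOT in the tree; `RigidOverBase` unchanged
(rigidity rows).  Binders: the kit's ∪ {I, x, hx, hxb} ∪ DATA {n, hn}; 0 instance · 0 notation · no new `Prop` fact; typed ≠ proved beyond what is here.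
-/

noncomputable section

namespace Literature.IUT.HodgeTheaters

open CategoryTheory Opposite Literature.AnabelianGeometry.SemiGraphs Literature.AlgebraicGeometry.Frobenioids

/-! ### §A. Γ-inner automorphisms of `P ↠ Γ`: the natural isomorphism `pull φ ⋙ push aug ≅ push aug` of small coset categories -/

namespace PiTransport

universe u

section ConjPush

variable {P : Type u} [Group P] [TopologicalSpace P] {Γ : Type u} [Group Γ] [TopologicalSpace Γ]
  (aug : P →* Γ) (ho : IsOpenMap aug) (φ : P →* P) (hφc : Continuous φ) (hφs : Function.Surjective φ)
  (γ : Γ) (hγ : ∀ z : P, aug (φ z) = γ * aug z * γ⁻¹)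

include hφs hγ in
/-- For a Γ-INNER automorphism `φ` of `P` over `aug` (`aug ∘ φ = conj γ ∘ aug`): `g ∈ aug(φ⁻¹U)` iff `γ g γ⁻¹ ∈ aug(U)`.
[cite: MochizukiFrdII2008, Ex 1.3 (ii) p.11] -/
theorem mem_mapOpen_comap_iff (U : OpenSubgroup P) (g : Γ) :
    g ∈ CosetCat.mapOpen aug ho (U.comap φ hφc) ↔ γ * g * γ⁻¹ ∈ CosetCat.mapOpen aug ho U := by
  rw [CosetCat.mem_mapOpen, CosetCat.mem_mapOpen]
  constructor
  · rintro ⟨z, hz, rfl⟩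
    exact ⟨φ z, OpenSubgroup.mem_comap.mp hz, by rw [hγ]⟩
  · rintro ⟨u, hu, hgu⟩
    obtain ⟨z, rfl⟩ := hφs u
    refine ⟨z, OpenSubgroup.mem_comap.mpr hu, ?_⟩
    rw [hγ] at hgu
    have h1 : aug z = g := by
      have h2 := congrArg (fun t => γ⁻¹ * t * γ) hgu
      simpa [mul_assoc] using h2
    exact h1

/-- The component at `P/U` of the natural isomorphism: `Γ/aug(φ⁻¹U) = Γ/γ⁻¹aug(U)γ → Γ/aug(U)`, `g ↦ g γ⁻¹`.
[cite: MochizukiFrdII2008, Ex 1.3 (ii) p.11] -/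
def conjPushHom (X : CosetCat P) :
    (CosetCat.push aug ho).obj ((CosetCat.pull φ hφc hφs).obj X) ⟶ (CosetCat.push aug ho).obj X :=
  CosetCat.homMk ((γ⁻¹ : Γ) : ((CosetCat.push aug ho).obj X).carrier) fun u hu => by
    rw [MulAction.Quotient.smul_coe, smul_eq_mul, QuotientGroup.eq]
    have hu' : γ * u * γ⁻¹ ∈ CosetCat.mapOpen aug ho X.sg := (mem_mapOpen_comap_iff aug ho φ hφc hφs γ hγ X.sg u).mp hu
    rw [show (u * γ⁻¹)⁻¹ * γ⁻¹ = (γ * u * γ⁻¹)⁻¹ by group]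
    exact inv_mem hu'

/-- … and its inverse `Γ/aug(U) → Γ/γ⁻¹aug(U)γ`, `g ↦ g γ`. [cite: MochizukiFrdII2008, Ex 1.3 (ii) p.11] -/
def conjPushInv (X : CosetCat P) :
    (CosetCat.push aug ho).obj X ⟶ (CosetCat.push aug ho).obj ((CosetCat.pull φ hφc hφs).obj X) :=
  CosetCat.homMk ((γ : Γ) : ((CosetCat.push aug ho).obj ((CosetCat.pull φ hφc hφs).obj X)).carrier) fun v hv => by
    rw [MulAction.Quotient.smul_coe, smul_eq_mul, QuotientGroup.eq]
    refine (mem_mapOpen_comap_iff aug ho φ hφc hφs γ hγ X.sg _).mpr ?_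
    rw [show γ * ((v * γ)⁻¹ * γ) * γ⁻¹ = v⁻¹ by group]
    exact inv_mem hv

/-- `pt (conjPushHom X) = γ⁻¹ · aug(U)`. [cite: MochizukiFrdII2008, Ex 1.3 (ii) p.11] -/
@[simp] theorem pt_conjPushHom (X : CosetCat P) :
    CosetCat.pt (conjPushHom aug ho φ hφc hφs γ hγ X) = ((γ⁻¹ : Γ) : ((CosetCat.push aug ho).obj X).carrier) :=
  CosetCat.pt_homMk _ _

/-- `pt (conjPushInv X) = γ · aug(φ⁻¹U)`. [cite: MochizukiFrdII2008, Ex 1.3 (ii) p.11] -/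
@[simp] theorem pt_conjPushInv (X : CosetCat P) :
    CosetCat.pt (conjPushInv aug ho φ hφc hφs γ hγ X) =
      ((γ : Γ) : ((CosetCat.push aug ho).obj ((CosetCat.pull φ hφc hφs).obj X)).carrier) :=
  CosetCat.pt_homMk _ _

/-- The component is an isomorphism. [cite: MochizukiFrdII2008, Ex 1.3 (ii) p.11] -/
def conjPushIsoApp (X : CosetCat P) :
    (CosetCat.push aug ho).obj ((CosetCat.pull φ hφc hφs).obj X) ≅ (CosetCat.push aug ho).obj X where
  hom := conjPushHom aug ho φ hφc hφs γ hγ X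
  inv := conjPushInv aug ho φ hφc hφs γ hγ X
  hom_inv_id := CosetCat.hom_ext (by
    rw [CosetCat.pt_comp, pt_conjPushHom, CosetCat.toFun_coe, pt_conjPushInv, MulAction.Quotient.smul_coe, smul_eq_mul,
      inv_mul_cancel, CosetCat.pt_id])
  inv_hom_id := CosetCat.hom_ext (by
    rw [CosetCat.pt_comp, pt_conjPushInv, CosetCat.toFun_coe, pt_conjPushHom, MulAction.Quotient.smul_coe, smul_eq_mul,
      mul_inv_cancel, CosetCat.pt_id])

/-- **`pull φ ⋙ push aug ≅ push aug` for a Γ-inner automorphism `φ` of `P` over `aug`** (naturality: both composites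
`Γ/γ⁻¹aug(U)γ → Γ/aug(U′)` have point `aug(z)·γ⁻¹` where `φ z` represents the point of `P/U → P/U′`).
[cite: MochizukiFrdII2008, Ex 1.3 (ii) p.11] -/
def conjPushIso : CosetCat.pull φ hφc hφs ⋙ CosetCat.push aug ho ≅ CosetCat.push aug ho :=
  NatIso.ofComponents (fun X => conjPushIsoApp aug ho φ hφc hφs γ hγ X) fun {X Y} h => by
    -- a representative `φ z` of the point of `h`
    obtain ⟨a, ha⟩ := QuotientGroup.mk_surjective (CosetCat.pt h)
    obtain ⟨z, rfl⟩ := hφs a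
    have hpull : CosetCat.pt ((CosetCat.pull φ hφc hφs).map h) = ((z : P) : ((CosetCat.pull φ hφc hφs).obj Y).carrier) := by
      rw [CosetCat.pt_pull_map, ← ha]
      exact CosetCat.pullEquiv_symm_coe φ hφc hφs Y z
    apply CosetCat.hom_ext
    change CosetCat.pt ((CosetCat.push aug ho).map ((CosetCat.pull φ hφc hφs).map h) ≫ conjPushHom aug ho φ hφc hφs γ hγ Y) =
      CosetCat.pt (conjPushHom aug ho φ hφc hφs γ hγ X ≫ (CosetCat.push aug ho).map h)
    rw [CosetCat.pt_comp, CosetCat.pt_push_map, hpull, CosetCat.pushQuot_coe, CosetCat.toFun_coe, pt_conjPushHom,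
      MulAction.Quotient.smul_coe, smul_eq_mul, CosetCat.pt_comp, pt_conjPushHom, CosetCat.toFun_coe, CosetCat.pt_push_map,
      ← ha, CosetCat.pushQuot_coe, MulAction.Quotient.smul_coe, smul_eq_mul, hγ, QuotientGroup.eq]
    rw [show (aug z * γ⁻¹)⁻¹ * (γ⁻¹ * (γ * aug z * γ⁻¹)) = 1 by group]
    exact one_mem _

/-- Components of `conjPushIso`. [cite: MochizukiFrdII2008, Ex 1.3 (ii) p.11] -/
theorem conjPushIso_hom_app (X : CosetCat P) :
    (conjPushIso aug ho φ hφc hφs γ hγ).hom.app X = conjPushHom aug ho φ hφc hφs γ hγ X := rfl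

end ConjPush

end PiTransport

/-! ### §B. The lift at the REAL `GoodLocalFrobenioid.ofGalois`: a Γ-inner automorphism of `(Π_v ↠ G_v)` induces a self-equivalence
of `𝒞_v` lying over `pull φ` ON THE NOSE ([FrdI] Thm 5.2 (i) transport `restrictAlong` + Cor 5.4 `DataHomOver.functor_isEquivalence`) -/

namespace GammaInnerLift

universe u

variable {p : ℕ} [Fact p.Prime] (d : GaloisValDatum.{u} p) {P : Type u} [Group P] [TopologicalSpace P]
  (aug : P →* d.Gal) (hc : Continuous aug) (hs : Function.Surjective aug) (ho : IsOpenMap aug)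
  (Kv : Type) [Field Kv] [ValuativeRel Kv] (hp : ((p : Kv)) ∈ PadicFrd.intNonzero Kv)
  (φ : P →* P) (hφc : Continuous φ) (hφs : Function.Surjective φ) (γ : d.Gal) (hγ : ∀ z : P, aug (φ z) = γ * aug z * γ⁻¹)

/-- The Γ-LEVEL perfection datum `ord(𝒪^▷)^pf` over `ℬ(G_v)⁰` ([FrdII] Ex 1.1 (ii); abc-iut-L1-t4 `Datum.perf` at abc-iut-L5-t2's field functor) —
the datum of which `𝒞_v`'s data are the restriction along `push aug` (abc-iut-L1-t4 `GoodLocalKit.perf_proj_eq_restrict`, rfl).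
[cite: MochizukiFrdII2008, Ex 1.1 (ii) p.8] -/
abbrev galoisPerfDatum : PadicFrd.Datum (CosetCat d.Gal) p :=
  PadicFrd.Datum.perf d.fieldFunctor d.fieldFunctor_isPadicLocal CosetCat.isConnected CosetCat.isTotallyEpimorphic

/-- **The morphism of model data OVER `pull φ`** induced by a Γ-inner automorphism `(φ, γ)`: abc-iut-L1 `ModelFrobenioid.restrictAlong`
along the natural isomorphism `conjPushIso : pull φ ⋙ push aug ≅ push aug` of §A, for the Γ-level perfection data — by `perf_proj_eq_restrict`
this IS a `DataHomOver (pull φ)` between `𝒞_v`'s own data. [cite: MochizukiFrdI2008, Thm. 5.2(i) p.100] -/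
def dataHomOver :
    ModelFrobenioid.DataHomOver (CosetCat.pull φ hφc hφs)
      (PadicFrd.Datum.perf (CosetCat.push aug ho ⋙ d.fieldFunctor)
        (GoodLocalFrobenioid.hlocOver (CosetCat.push aug ho) d.fieldFunctor d.fieldFunctor_isPadicLocal)
        CosetCat.isConnected CosetCat.isTotallyEpimorphic).divB
      (PadicFrd.Datum.perf (CosetCat.push aug ho ⋙ d.fieldFunctor)
        (GoodLocalFrobenioid.hlocOver (CosetCat.push aug ho) d.fieldFunctor d.fieldFunctor_isPadicLocal)
        CosetCat.isConnected CosetCat.isTotallyEpimorphic).divB :=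
  ModelFrobenioid.restrictAlong (G₁ := CosetCat.push aug ho) (G₂ := CosetCat.pull φ hφc hφs ⋙ CosetCat.push aug ho)
    (PiTransport.conjPushIso aug ho φ hφc hφs γ hγ).hom (galoisPerfDatum d).Φ (galoisPerfDatum d).B (galoisPerfDatum d).divB

/-- **THE LIFT `Ψ_φ : 𝒞_v ⥤ 𝒞_v`** of a Γ-inner automorphism (the functor of `dataHomOver`: `(A, α) ↦ (φ⁻¹A, Φ(γ)α)` — «surjectivity follows
immediately from the construction», [IUTchI] p.144 l.41–43, here for OUR transporters). ([IUTchI] Cor 5.3 (ii) p.144) [claim: Mochizuki2012, status: disputed] -/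
def lift : (GoodLocalFrobenioid.ofGalois d aug hc hs ho Kv hp).Cv ⥤ (GoodLocalFrobenioid.ofGalois d aug hc hs ho Kv hp).Cv :=
  (dataHomOver d aug ho φ hφc hφs γ hγ).functor

/-- **`Ψ_φ` LIES OVER `pull φ` ON THE NOSE**: `Ψ_φ ⋙ toBase = toBase ⋙ pull φ` (abc-iut-w5-d048 `DataHomOver.functor_comp_baseFunctor`).
([IUTchI] Cor 5.3 (ii) p.144) [claim: Mochizuki2012, status: disputed] -/
theorem lift_comp_toBase :
    lift d aug hc hs ho Kv hp φ hφc hφs γ hγ ⋙ (GoodLocalFrobenioid.ofGalois d aug hc hs ho Kv hp).toBase =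
      (GoodLocalFrobenioid.ofGalois d aug hc hs ho Kv hp).toBase ⋙ CosetCat.pull φ hφc hφs :=
  (dataHomOver d aug ho φ hφc hφs γ hγ).functor_comp_baseFunctor

/-- The components of the data morphism are BIJECTIVE (they are `Φ`, `B` of the Γ-level datum applied to the components of the
natural ISOMORPHISM `conjPushIso`). [cite: MochizukiFrdI2008, Cor. 5.4 p.104] -/
theorem dataHomOver_η_bijective (X : CosetCat P) :
    Function.Bijective ((dataHomOver d aug ho φ hφc hφs γ hγ).η.app (op X)).hom := by
  change Function.Bijective ((galoisPerfDatum d).Φ.map ((PiTransport.conjPushIso aug ho φ hφc hφs γ hγ).hom.app X).op).hom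
  exact ((galoisPerfDatum d).Φ.mapIso ((PiTransport.conjPushIsoApp aug ho φ hφc hφs γ hγ X).op)).commMonCatIsoToMulEquiv.bijective

/-- … and likewise for `B`. [cite: MochizukiFrdI2008, Cor. 5.4 p.104] -/
theorem dataHomOver_β_bijective (X : CosetCat P) :
    Function.Bijective ((dataHomOver d aug ho φ hφc hφs γ hγ).β.app (op X)).hom := by
  change Function.Bijective ((galoisPerfDatum d).B.map ((PiTransport.conjPushIso aug ho φ hφc hφs γ hγ).hom.app X).op).hom
  exact ((galoisPerfDatum d).B.mapIso ((PiTransport.conjPushIsoApp aug ho φ hφc hφs γ hγ X).op)).commMonCatIsoToMulEquiv.bijective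

variable (ψ : P →* P) (hψc : Continuous ψ) (h₁ : φ.comp ψ = MonoidHom.id P) (h₂ : ψ.comp φ = MonoidHom.id P)

include ψ hψc h₁ h₂ in
/-- **`Ψ_φ` is an EQUIVALENCE** when `φ` has a continuous inverse `ψ` ([FrdI] Cor 5.4 «the horizontal arrows are equivalences»:
abc-iut-w5-d137 `DataHomOver.functor_isEquivalence` over the equivalence `pull φ` with bijective components).
[cite: MochizukiFrdI2008, Cor. 5.4 p.104] -/
theorem lift_isEquivalence : (lift d aug hc hs ho Kv hp φ hφc hφs γ hγ).IsEquivalence := by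
  haveI : (CosetCat.pull φ hφc hφs).IsEquivalence :=
    (PiTransport.pullSelfEquiv φ ψ hφc hψc h₁ h₂).isEquivalence_functor
  exact (dataHomOver d aug ho φ hφc hφs γ hγ).functor_isEquivalence (dataHomOver_η_bijective d aug ho φ hφc hφs γ hγ)
    (dataHomOver_β_bijective d aug ho φ hφc hφs γ hγ)

include hφs γ hγ in
/-- **THE Γ-INNER LIFT AT THE REAL `𝒞_v`**: for every automorphism `φ` of `Π_v` with continuous inverse lying over an INNER automorphism of
`G_v` (`aug ∘ φ = conj γ ∘ aug`), there is a self-equivalence of `𝒞_v = (GoodLocalFrobenioid.ofGalois d aug …).Cv` LYING UNDER the transport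
self-equivalence `pullSelfEquiv φ ψ` of `ℬ(Π_v)⁰` through `toBase` — print's «surjectivity follows immediately from the construction» for this class
of automorphisms of `𝒟_v`, as a THEOREM about abc-iut-L5-t2's construction. ([IUTchI] Cor 5.3 (ii) p.144) [claim: Mochizuki2012, status: disputed] -/
theorem exists_selfEquivalence_liesUnder_pullSelfEquiv :
    ∃ Ψ : (GoodLocalFrobenioid.ofGalois d aug hc hs ho Kv hp).Cv ≌ (GoodLocalFrobenioid.ofGalois d aug hc hs ho Kv hp).Cv,
      Nonempty (CatIsomorphism.LiesUnder (GoodLocalFrobenioid.ofGalois d aug hc hs ho Kv hp).toBase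
        (GoodLocalFrobenioid.ofGalois d aug hc hs ho Kv hp).toBase Ψ (PiTransport.pullSelfEquiv φ ψ hφc hψc h₁ h₂)) := by
  haveI := lift_isEquivalence d aug hc hs ho Kv hp φ hφc hφs γ hγ ψ hψc h₁ h₂
  refine ⟨(lift d aug hc hs ho Kv hp φ hφc hφs γ hγ).asEquivalence, ⟨?_⟩⟩
  change lift d aug hc hs ho Kv hp φ hφc hφs γ hγ ⋙ (GoodLocalFrobenioid.ofGalois d aug hc hs ho Kv hp).toBase ≅
    (GoodLocalFrobenioid.ofGalois d aug hc hs ho Kv hp).toBase ⋙ CosetCat.pull φ hφc _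
  exact eqToIso (lift_comp_toBase d aug hc hs ho Kv hp φ hφc hφs γ hγ)

end GammaInnerLift

/-! ### §C. Transporters of the embedded `Π_v̲` as Γ-inner automorphisms of `Π_{(−)} ×_{G_F} Γ` -/

namespace InitialThetaData

section Transporter

universe uF vK

variable {F : Type uF} {K : Type vK} {Fbar : Type} [Field F] [NumberField F] [Field K] [NumberField K]
  [Algebra F K] [Field Fbar] [Algebra F Fbar] [Algebra K Fbar]
  {E : WeierstrassCurve F} [E.IsElliptic] {l : ℕ} {Pb : BadPlacePredicates K}
  (D : InitialThetaData F K Fbar E l Pb) (H : Subgroup D.PiC)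
  {Γ : Type} [Group Γ] [TopologicalSpace Γ] (ρ : Γ →* (Fbar ≃ₐ[F] Fbar)) (hρ : Function.Injective ρ)

/-- **The transporter automorphism of `Π_{(−)_v̲} = Π_{(−)} ×_{G_F} Γ`** attached to an element `n` of the normaliser of the embedded
`Π_{(−)} ∩ augGF⁻¹(ρ(Γ))` in `Π_{C_F}`: conjugation by `n`, read on the fibre product through `piLocEquiv` (Def 3.1 (e): the «injections of
profinite groups»; Def 6.1 (v): ambient elements acting on embedded objects). ([IUTchI] Def 3.1 (e) p.62) [claim: Mochizuki2012, status: disputed] -/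
def transporterEnd (n : ↥(Subgroup.normalizer (((H ⊓ ρ.range.comap D.augGF : Subgroup D.PiC)) : Set D.PiC))) :
    D.PiLoc H ρ →* D.PiLoc H ρ :=
  ((D.piLocEquiv H ρ hρ).symm.toMonoidHom.comp (PiTransport.conjSub _ n)).comp (D.piLocEquiv H ρ hρ).toMonoidHom

omit [TopologicalSpace Γ] in
/-- `transporterEnd n` followed by `transporterEnd n⁻¹` is the identity. ([IUTchI] Def 3.1 (e) p.62) [claim: Mochizuki2012, status: disputed] -/
theorem transporterEnd_comp_inv (n : ↥(Subgroup.normalizer (((H ⊓ ρ.range.comap D.augGF : Subgroup D.PiC)) : Set D.PiC))) :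
    (D.transporterEnd H ρ hρ n).comp (D.transporterEnd H ρ hρ n⁻¹) = MonoidHom.id _ := by
  ext1 z
  change (D.piLocEquiv H ρ hρ).symm (PiTransport.conjSub _ n ((D.piLocEquiv H ρ hρ) ((D.piLocEquiv H ρ hρ).symm
    (PiTransport.conjSub _ n⁻¹ ((D.piLocEquiv H ρ hρ) z))))) = z
  rw [MulEquiv.apply_symm_apply, ← MonoidHom.comp_apply, PiTransport.conjSub_comp_inv, MonoidHom.id_apply,
    MulEquiv.symm_apply_apply]

omit [TopologicalSpace Γ] in
/-- `transporterEnd n⁻¹` followed by `transporterEnd n` is the identity. ([IUTchI] Def 3.1 (e) p.62) [claim: Mochizuki2012, status: disputed] -/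
theorem transporterEnd_inv_comp (n : ↥(Subgroup.normalizer (((H ⊓ ρ.range.comap D.augGF : Subgroup D.PiC)) : Set D.PiC))) :
    (D.transporterEnd H ρ hρ n⁻¹).comp (D.transporterEnd H ρ hρ n) = MonoidHom.id _ := by
  have h := D.transporterEnd_comp_inv H ρ hρ n⁻¹
  rwa [inv_inv] at h

/-- `transporterEnd` is continuous when `piLocEquiv` is a homeomorphism (`Π_{(−)}` open, `ρ` continuous, `Γ` compact).
([IUTchI] Def 3.1 (e) p.62) [claim: Mochizuki2012, status: disputed] -/
theorem continuous_transporterEnd [CompactSpace Γ] (hX : IsOpen (H : Set D.PiC)) (hρc : Continuous ρ)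
    (n : ↥(Subgroup.normalizer (((H ⊓ ρ.range.comap D.augGF : Subgroup D.PiC)) : Set D.PiC))) :
    Continuous (D.transporterEnd H ρ hρ n) :=
  ((D.continuous_piLocEquiv_symm H ρ hX hρc hρ).comp (PiTransport.continuous_conjSub _ n)).comp
    (D.continuous_piLocEquiv H ρ hρ)

omit [TopologicalSpace Γ] in
/-- The underlying `Π_{C_F}`-coordinate of `transporterEnd n z` is `n · z · n⁻¹`. ([IUTchI] Def 3.1 (e) p.62) [claim: Mochizuki2012, status: disputed] -/
theorem coe_transporterEnd (n : ↥(Subgroup.normalizer (((H ⊓ ρ.range.comap D.augGF : Subgroup D.PiC)) : Set D.PiC)))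
    (z : D.PiLoc H ρ) : ((D.transporterEnd H ρ hρ n z : D.PiLoc H ρ) : D.PiC × Γ).1 = (n : D.PiC) * (z : D.PiC × Γ).1 * (n : D.PiC)⁻¹ := by
  change (((D.piLocEquiv H ρ hρ).symm (PiTransport.conjSub _ n ((D.piLocEquiv H ρ hρ) z)) : D.PiLoc H ρ) : D.PiC × Γ).1 = _
  have h := D.coe_piLocEquiv H ρ hρ ((D.piLocEquiv H ρ hρ).symm (PiTransport.conjSub _ n ((D.piLocEquiv H ρ hρ) z)))
  rw [MulEquiv.apply_symm_apply, PiTransport.coe_conjSub, D.coe_piLocEquiv H ρ hρ z] at h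
  exact h.symm

omit [TopologicalSpace Γ] in
/-- **A Γ-INNER transporter acts over an inner automorphism of `Γ`**: if `augGF n = ρ γ` then
`augLoc (transporterEnd n z) = γ · augLoc z · γ⁻¹` (injectivity of `ρ` and the cartesian square of Def 3.1 (e)).
([IUTchI] Def 3.1 (e) p.62) [claim: Mochizuki2012, status: disputed] -/
theorem augLoc_transporterEnd (n : ↥(Subgroup.normalizer (((H ⊓ ρ.range.comap D.augGF : Subgroup D.PiC)) : Set D.PiC)))
    (γ : Γ) (hγ : D.augGF (n : D.PiC) = ρ γ) (z : D.PiLoc H ρ) :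
    D.augLoc H ρ (D.transporterEnd H ρ hρ n z) = γ * D.augLoc H ρ z * γ⁻¹ := by
  apply hρ
  have h1 := D.augGF_fstLoc H ρ (D.transporterEnd H ρ hρ n z)
  have h2 := D.augGF_fstLoc H ρ z
  rw [D.fstLoc_apply] at h1 h2
  rw [← h1, D.coe_transporterEnd H ρ hρ n z, map_mul, map_mul, map_inv, h2, hγ, ← map_inv, ← map_mul, ← map_mul]

end Transporter


end InitialThetaData

end Literature.IUT.HodgeTheaters

end
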